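import Summits.FinalStateConjecture.FinalStateConjecture.Theorems.EIHFluxBalanceInertialRecessionRechartHolePackage2

/-!
# Route EIHFluxBalance — `InertialRecession`, re-charting: the lab ↔ model dictionary of the
# re-charted `a = 0` hole charts

Helper file for the crux `stmt-FinalStateConjecture-10166`
(`Summit.FinalStateConjecture.FinalStateConjecture.Theses.EIHFluxBalance.InertialRecession`),
stub `stub_rechart` (the transfer P2 of line `sublinear-is-free-clean-window-charges`).

The causal transfer (files `…RechartTransfer`, `…RechartHover`) reads the hole charts
`ψ = Φ ∘ A` of the `a = 0` package through a DICTIONARY between a late lab point `x` near hole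
`i` and the model point `y` with `ψ y = Φ x`: `r(y) = rᵢ(x)` (model radius = painted radius,
exactly) and `|t*(y) − x⁰/γ| ≤ ‖V‖·rᵢ(x)` (hole time vs lab time). This file derives it from the
exports of `hole_chart_package2'` (coverage of the painted near zone, two-sided painted radius,
lab-time function), for ONE hole with data `(M, V, ξ, v, Λ)`:

* `norm_restOffsetInv_le`, `lorentzGamma_le_of_norm_le` — `‖P_v z‖ ≤ γ(v)‖z‖ ≤ γ₀‖z‖`
  (`r₊ = 2M` for spin `0` is the Literature lemma `Kerr.rPlus_zero_right`);
* `exists_model_of_lab` — every lab point `x` with `x⁰ ≥ T + 1`, `r₊ < rᵢ(x)` and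
  `γ₀ rᵢ(x) ≤ ρ(x⁰)/2` is `ψ y` with `r(y) = rᵢ(x)`, `|t*(y) − x⁰/γ| ≤ ‖V‖ rᵢ(x)`;
* `lab_of_model` — every model point `y` with `y⁰ ≥ T + 1`, `r(y) ≤ ρ(y⁰)/2` has lab point `A y`
  of lab time `y⁰`, painted radius `r(y)` and `|t*(y) − y⁰/γ| ≤ ‖V‖ r(y)`; and
  `apply_zero_ge_of_model` — `y⁰ ≥ γ (t*(y) − ‖V‖ r(y))`.

[folklore; Jackson (11.19)]
-/

noncomputable section

set_option linter.dupNamespace false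

open scoped Topology ContDiff InnerProductSpace Manifold ENNReal
open Filter Set Metric Function TopologicalSpace Literature.Geometry.Lorentzian

namespace Summit.FinalStateConjecture.FinalStateConjecture.Theorems

/-! ### `‖P_v z‖ ≤ γ‖z‖` and `γ(v) ≤ γ₀` -/

/-- The painted rest offset `P_v z = z + (γ²/(γ+1))⟪v, z⟫ v` has norm at most `γ(v)‖z‖`
(`γ²‖v‖² = γ² − 1`). Jackson (11.19). [folklore] -/
theorem norm_restOffsetInv_le {v : E3} (hv : ‖v‖ < 1) (z : E3) :
    ‖z + (Lorentz.gamma v ^ 2 / (Lorentz.gamma v + 1) * inner ℝ v z) • v‖ ≤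
      Lorentz.gamma v * ‖z‖ := by
  have hγ := Lorentz.gamma_pos hv
  have hγ1 := lorentzGamma_add_one_pos v
  have hk := Lorentz.gamma_sq_mul hv
  have h1 : ‖(Lorentz.gamma v ^ 2 / (Lorentz.gamma v + 1) * inner ℝ v z) • v‖ ≤
      (Lorentz.gamma v - 1) * ‖z‖ := by
    rw [norm_smul, Real.norm_eq_abs, abs_mul, abs_div, abs_of_pos hγ1,
      abs_of_nonneg (sq_nonneg _)]
    have h2 : |inner ℝ v z| ≤ ‖v‖ * ‖z‖ := abs_real_inner_le_norm v z
    have h3 : Lorentz.gamma v ^ 2 / (Lorentz.gamma v + 1) * |inner ℝ v z| * ‖v‖ ≤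
        Lorentz.gamma v ^ 2 / (Lorentz.gamma v + 1) * (‖v‖ * ‖z‖) * ‖v‖ :=
      mul_le_mul_of_nonneg_right (mul_le_mul_of_nonneg_left h2 (by positivity)) (norm_nonneg _)
    refine h3.trans (le_of_eq ?_)
    have h4 : Lorentz.gamma v ^ 2 * ‖v‖ ^ 2 = (Lorentz.gamma v - 1) * (Lorentz.gamma v + 1) := by
      nlinarith
    field_simp
    nlinarith [h4, norm_nonneg z]
  calc ‖z + (Lorentz.gamma v ^ 2 / (Lorentz.gamma v + 1) * inner ℝ v z) • v‖
      ≤ ‖z‖ + ‖(Lorentz.gamma v ^ 2 / (Lorentz.gamma v + 1) * inner ℝ v z) • v‖ := norm_add_le _ _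
    _ ≤ ‖z‖ + (Lorentz.gamma v - 1) * ‖z‖ := by linarith
    _ = Lorentz.gamma v * ‖z‖ := by ring

/-- Registered one-line form (stub `norm_restOffsetInv_le_rechart` of the crux item) of
`norm_restOffsetInv_le`. [folklore] -/
theorem norm_restOffsetInv_le_rechart : open Literature.Geometry.Lorentzian in ∀ {v : E3}, ‖v‖ < 1 → ∀ z : E3, ‖z + (Lorentz.gamma v ^ 2 / (Lorentz.gamma v + 1) * inner ℝ v z) • v‖ ≤ Lorentz.gamma v * ‖z‖ :=
  fun hv z ↦ norm_restOffsetInv_le hv z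

/-- The Lorentz factor is monotone in the speed: `γ(v) ≤ (√(1 − κ₀²))⁻¹` when `‖v‖ ≤ κ₀ < 1`.
[folklore] -/
theorem lorentzGamma_le_of_norm_le {v : E3} {κ₀ : ℝ} (hκ₀ : κ₀ < 1) (hv : ‖v‖ ≤ κ₀) :
    Lorentz.gamma v ≤ (Real.sqrt (1 - κ₀ ^ 2))⁻¹ := by
  have hκ : 0 ≤ κ₀ := (norm_nonneg v).trans hv
  have h1 : 0 < 1 - κ₀ ^ 2 := by nlinarith
  have h2 : 1 - κ₀ ^ 2 ≤ 1 - ‖v‖ ^ 2 := by nlinarith [norm_nonneg v]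
  unfold Lorentz.gamma
  exact inv_anti₀ (Real.sqrt_pos.mpr h1) (Real.sqrt_le_sqrt h2)

/-- `1 ≤ (√(1 − κ₀²))⁻¹` for `0 ≤ κ₀ < 1`. [folklore] -/
theorem one_le_inv_sqrt_one_sub_sq {κ₀ : ℝ} (hκ : 0 ≤ κ₀) (hκ₀ : κ₀ < 1) :
    1 ≤ (Real.sqrt (1 - κ₀ ^ 2))⁻¹ := by
  have h1 : 0 < 1 - κ₀ ^ 2 := by nlinarith
  rw [one_le_inv₀ (Real.sqrt_pos.mpr h1), Real.sqrt_le_one]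
  nlinarith

/-! ### The dictionary of one re-charted hole -/

section Dictionary

variable {𝓢 : Spacetime 4} (U : Opens E4) (Φ : U → 𝓢.carrier) {M : ℝ} (hM : 0 < M) {V : E3}
  (hV : ‖V‖ < 1) (ξ v : ℝ → E3) (hv1 : ∀ t, ‖v t‖ < 1) {κ₀ : ℝ} (hκ₀ : κ₀ < 1)
  (hvs : ∀ t, ‖v t‖ ≤ κ₀) (Λ : ℝ → lorentzGroup)
  (hfut : ∀ t, 0 < (((Λ t : E4 ≃L[ℝ] E4) (E4.basisVector 0)) 0))
  (hvΛ : ∀ t, E4.spatial ((Λ t : E4 ≃L[ℝ] E4) (E4.basisVector 0)) =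
    (((Λ t : E4 ≃L[ℝ] E4) (E4.basisVector 0)) 0) • v t)
  {A : E4 → E4} {T : ℝ} {ρ θ : ℝ → ℝ}
  (hAU : ∀ x ∈ (boostedKerrBackground (Lorentz.boost V hV) 0 M 0).domain, A x ∈ U)
  -- exports of `hole_chart_package2'` (with `ξ i ↦ ξ`, `v i ↦ v`)
  (hcovA : ∀ x : E4, T + 1 ≤ x 0 →
    ‖E4.spatial x - ξ (x 0) + (Lorentz.gamma (v (x 0)) ^ 2 / (Lorentz.gamma (v (x 0)) + 1) *
      inner ℝ (v (x 0)) (E4.spatial x - ξ (x 0))) • v (x 0)‖ ≤ ρ (x 0) / 2 →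
    ∃ x' : E4, A x' = x ∧ x' 0 = x 0 ∧
      E4.spatial ((Lorentz.boost V hV : E4 ≃L[ℝ] E4).symm x') = E4.spatial x - ξ (x 0) +
        (Lorentz.gamma (v (x 0)) ^ 2 / (Lorentz.gamma (v (x 0)) + 1) *
          inner ℝ (v (x 0)) (E4.spatial x - ξ (x 0))) • v (x 0) ∧
      ((Lorentz.boost V hV : E4 ≃L[ℝ] E4).symm x') 0 =
        x 0 / Lorentz.gamma V - inner ℝ V (E4.spatial x - ξ (x 0) +
          (Lorentz.gamma (v (x 0)) ^ 2 / (Lorentz.gamma (v (x 0)) + 1) *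
            inner ℝ (v (x 0)) (E4.spatial x - ξ (x 0))) • v (x 0)))
  (hrad2 : ∀ (x : E4) (Λ' : lorentzGroup), 0 < ((Λ' : E4 ≃L[ℝ] E4) (E4.basisVector 0)) 0 →
    E4.spatial ((Λ' : E4 ≃L[ℝ] E4) (E4.basisVector 0)) =
      (((Λ' : E4 ≃L[ℝ] E4) (E4.basisVector 0)) 0) • v (A x 0) →
    min ‖E4.spatial ((Lorentz.boost V hV : E4 ≃L[ℝ] E4).symm x)‖ (ρ (A x 0) / 2) ≤
        E4.spatialNorm ((Λ' : E4 ≃L[ℝ] E4).symm (A x - E4.ofTimeSpace (A x 0) (ξ (A x 0)))) ∧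
      E4.spatialNorm ((Λ' : E4 ≃L[ℝ] E4).symm (A x - E4.ofTimeSpace (A x 0) (ξ (A x 0)))) ≤
        ‖E4.spatial ((Lorentz.boost V hV : E4 ≃L[ℝ] E4).symm x)‖)
  (hAθ : ∀ x : E4, A x 0 = θ (x 0)) (hθid : ∀ s, T + 1 ≤ s → θ s = s)

/-- The painted radius of a lab point dominates its lab distance from the centre:
`‖x̲ − ξ(x⁰)‖ ≤ rᵢ(x)` (boosts stretch). [folklore] -/
theorem norm_sub_centre_le_paintedRadius (x : E4) :
    ‖E4.spatial x - ξ (x 0)‖ ≤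
      Kerr.radius 0 (poincareInv (Λ (x 0)) (E4.ofTimeSpace (x 0) (ξ (x 0))) x) := by
  obtain ⟨h0, hn⟩ := sub_ofTimeSpace_apply_zero (rfl : x 0 = x 0) (ξ (x 0))
  have h1 := norm_le_spatialNorm_lorentz_apply (Λ (x 0))⁻¹ h0
  rw [coe_lorentz_inv] at h1
  rw [radius_poincareInv_eq, Kerr.radius_zero_left, ContinuousLinearEquiv.coe_coe, ← hn]
  exact h1

include hM hv1 hκ₀ hvs hfut hvΛ hcovA hrad2 in
/-- **Lab → model.** A lab point `x` of lab time `x⁰ ≥ T + 1`, outside the painted horizon of the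
hole and with `γ₀ rᵢ(x) ≤ ρ(x⁰)/2` (`γ₀ = (1 − κ₀²)^{-1/2}`), is `ψ y = Φ x` for a model point `y` of
the boosted Schwarzschild exterior with `r(y) = rᵢ(x)` EXACTLY and `|t*(y) − x⁰/γ| ≤ ‖V‖ rᵢ(x)`.
[folklore] -/
theorem exists_model_of_lab (x : U) (hx0 : T + 1 ≤ x.1 0)
    (hxr : Kerr.rPlus M 0 <
      Kerr.radius 0 (poincareInv (Λ (x.1 0)) (E4.ofTimeSpace (x.1 0) (ξ (x.1 0))) x.1))
    (hxρ : (Real.sqrt (1 - κ₀ ^ 2))⁻¹ *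
      Kerr.radius 0 (poincareInv (Λ (x.1 0)) (E4.ofTimeSpace (x.1 0) (ξ (x.1 0))) x.1) ≤
        ρ (x.1 0) / 2) :
    ∃ y : (boostedKerrBackground (Lorentz.boost V hV) 0 M 0).domain,
      Φ ⟨A y.1, hAU y.1 y.2⟩ = Φ x ∧
      (boostedKerrBackground (Lorentz.boost V hV) 0 M 0).radius y.1 =
        Kerr.radius 0 (poincareInv (Λ (x.1 0)) (E4.ofTimeSpace (x.1 0) (ξ (x.1 0))) x.1) ∧
      |(boostedKerrBackground (Lorentz.boost V hV) 0 M 0).time y.1 - (Lorentz.gamma V)⁻¹ * x.1 0| ≤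
        ‖V‖ * Kerr.radius 0 (poincareInv (Λ (x.1 0)) (E4.ofTimeSpace (x.1 0) (ξ (x.1 0))) x.1) := by
  set t := x.1 0 with ht
  set rp := Kerr.radius 0 (poincareInv (Λ t) (E4.ofTimeSpace t (ξ t)) x.1) with hrp
  set w : E3 := E4.spatial x.1 - ξ t with hw
  set P : E3 := w + (Lorentz.gamma (v t) ^ 2 / (Lorentz.gamma (v t) + 1) * inner ℝ (v t) w) • v t
    with hP
  have hκ : 0 ≤ κ₀ := (norm_nonneg (v t)).trans (hvs t)
  have hγ₀ := one_le_inv_sqrt_one_sub_sq hκ hκ₀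
  -- `‖P‖ ≤ γ₀ rp ≤ ρ/2`
  have hwle : ‖w‖ ≤ rp := norm_sub_centre_le_paintedRadius ξ Λ x.1
  have hPle : ‖P‖ ≤ (Real.sqrt (1 - κ₀ ^ 2))⁻¹ * rp := by
    refine (norm_restOffsetInv_le (hv1 t) w).trans ?_
    exact mul_le_mul (lorentzGamma_le_of_norm_le hκ₀ (hvs t)) hwle (norm_nonneg _)
      (le_trans zero_le_one hγ₀)
  have hPρ : ‖P‖ ≤ ρ t / 2 := hPle.trans hxρ
  obtain ⟨x', hAx', hx'0, hsp, htime⟩ := hcovA x.1 hx0 hPρ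
  -- the painted radius at `x = A x'` equals `‖P‖`
  have hx't : A x' 0 = t := by rw [hAx']
  obtain ⟨hlow, hup⟩ := hrad2 x' (Λ t) (hfut t) (by rw [hx't]; exact hvΛ t)
  rw [hsp, hAx'] at hlow hup
  rw [← ht] at hlow hup
  rw [← hw] at hlow hup
  rw [← hP] at hlow hup
  have hrpP : rp = ‖P‖ := by
    have e : x.1 - E4.ofTimeSpace t (ξ t) = x.1 - E4.ofTimeSpace t (ξ t) := rfl
    have hrp' : rp = E4.spatialNorm (((Λ t : E4 ≃L[ℝ] E4)).symm (x.1 - E4.ofTimeSpace t (ξ t))) := by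
      rw [hrp, radius_poincareInv_eq, Kerr.radius_zero_left, ContinuousLinearEquiv.coe_coe]
    rw [hrp']
    have hmin : min ‖P‖ (ρ t / 2) = ‖P‖ := min_eq_left hPρ
    exact le_antisymm hup (hmin.symm.le.trans hlow)
  -- the model point
  have hsn : E4.spatialNorm (((Lorentz.boost V hV : E4 ≃L[ℝ] E4)).symm x') = rp := by
    rw [E4.spatialNorm, hsp, ← ht, ← hw, ← hP, hrpP]
  have hr2 : 0 < Kerr.rPlus M 0 := by rw [Kerr.rPlus_zero_right hM.le]; linarith
  have hmem : x' ∈ (boostedKerrBackground (Lorentz.boost V hV) 0 M 0).domain := by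
    change x' ∈ boostedKerrExterior (Lorentz.boost V hV) 0 M 0
    rw [mem_boostedKerrExterior, Kerr.mem_exterior, poincareInv_zero, Kerr.radius_zero_left, hsn,
      max_eq_left hr2.le]
    exact hxr
  refine ⟨⟨x', hmem⟩, ?_, ?_, ?_⟩
  · congr 1
    exact Subtype.ext hAx'
  · show Kerr.radius 0 (poincareInv (Lorentz.boost V hV) 0 x') = rp
    rw [poincareInv_zero, Kerr.radius_zero_left, hsn]
  · show |(poincareInv (Lorentz.boost V hV) 0 x') 0 - (Lorentz.gamma V)⁻¹ * t| ≤ ‖V‖ * rp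
    rw [poincareInv_zero, htime, hrpP]
    rw [show t / Lorentz.gamma V - inner ℝ V P - (Lorentz.gamma V)⁻¹ * t = -inner ℝ V P by ring,
      abs_neg]
    exact abs_real_inner_le_norm V P

include hrad2 hAθ hθid hfut hvΛ in
/-- **Model → lab.** A model point `y` with `y⁰ ≥ T + 1` and `r(y) ≤ ρ(y⁰)/2` has lab point
`A y` of lab time `y⁰`, painted radius `r(y)` EXACTLY, and `|t*(y) − y⁰/γ| ≤ ‖V‖ r(y)`.
[folklore] -/
theorem lab_of_model (y : (boostedKerrBackground (Lorentz.boost V hV) 0 M 0).domain)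
    (hy0 : T + 1 ≤ y.1 0)
    (hyρ : (boostedKerrBackground (Lorentz.boost V hV) 0 M 0).radius y.1 ≤ ρ (y.1 0) / 2) :
    A y.1 0 = y.1 0 ∧
      Kerr.radius 0 (poincareInv (Λ (A y.1 0)) (E4.ofTimeSpace (A y.1 0) (ξ (A y.1 0))) (A y.1)) =
        (boostedKerrBackground (Lorentz.boost V hV) 0 M 0).radius y.1 ∧
      |(boostedKerrBackground (Lorentz.boost V hV) 0 M 0).time y.1 - (Lorentz.gamma V)⁻¹ * y.1 0| ≤
        ‖V‖ * (boostedKerrBackground (Lorentz.boost V hV) 0 M 0).radius y.1 := by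
  have hA0 : A y.1 0 = y.1 0 := by rw [hAθ, hθid _ hy0]
  have hrad : (boostedKerrBackground (Lorentz.boost V hV) 0 M 0).radius y.1 =
      ‖E4.spatial (((Lorentz.boost V hV : E4 ≃L[ℝ] E4)).symm y.1)‖ := by
    show Kerr.radius 0 (poincareInv (Lorentz.boost V hV) 0 y.1) = _
    rw [poincareInv_zero, Kerr.radius_zero_left, E4.spatialNorm]
  refine ⟨hA0, ?_, ?_⟩
  · obtain ⟨hlow, hup⟩ := hrad2 y.1 (Λ (A y.1 0)) (hfut _) (hvΛ _)
    rw [radius_poincareInv_eq, Kerr.radius_zero_left, ContinuousLinearEquiv.coe_coe, hrad]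
    refine le_antisymm hup ?_
    have hmin : min ‖E4.spatial (((Lorentz.boost V hV : E4 ≃L[ℝ] E4)).symm y.1)‖ (ρ (A y.1 0) / 2) =
        ‖E4.spatial (((Lorentz.boost V hV : E4 ≃L[ℝ] E4)).symm y.1)‖ :=
      min_eq_left (by rw [hA0, ← hrad]; exact hyρ)
    rw [← hmin]
    exact hlow
  · -- `y⁰ = γ (t* + ⟪V, y̲⟫)`
    have hy : y.1 0 = Lorentz.gamma V * ((poincareInv (Lorentz.boost V hV) 0 y.1) 0 +
        inner ℝ V (E4.spatial (poincareInv (Lorentz.boost V hV) 0 y.1))) := by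
      rw [poincareInv_zero]
      conv_lhs => rw [← ((Lorentz.boost V hV : E4 ≃L[ℝ] E4)).apply_symm_apply y.1]
      rw [Lorentz.coe_boost_apply, Lorentz.boostCLM_apply_zero]
    have hγ := Lorentz.gamma_pos hV
    show |(poincareInv (Lorentz.boost V hV) 0 y.1) 0 - (Lorentz.gamma V)⁻¹ * y.1 0| ≤ _
    rw [hy, hrad, poincareInv_zero]
    rw [show (((Lorentz.boost V hV : E4 ≃L[ℝ] E4)).symm y.1) 0 - (Lorentz.gamma V)⁻¹ *
        (Lorentz.gamma V * ((((Lorentz.boost V hV : E4 ≃L[ℝ] E4)).symm y.1) 0 +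
          inner ℝ V (E4.spatial (((Lorentz.boost V hV : E4 ≃L[ℝ] E4)).symm y.1)))) =
        -inner ℝ V (E4.spatial (((Lorentz.boost V hV : E4 ≃L[ℝ] E4)).symm y.1)) by
      field_simp; ring, abs_neg]
    exact abs_real_inner_le_norm _ _

/-- **Lab time of a model point from below**: `y⁰ ≥ γ (t*(y) − ‖V‖ r(y))`. [folklore] -/
theorem apply_zero_ge_of_model (y : E4) :
    Lorentz.gamma V * ((boostedKerrBackground (Lorentz.boost V hV) 0 M 0).time y -
        ‖V‖ * (boostedKerrBackground (Lorentz.boost V hV) 0 M 0).radius y) ≤ y 0 := by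
  have hy : y 0 = Lorentz.gamma V * ((poincareInv (Lorentz.boost V hV) 0 y) 0 +
      inner ℝ V (E4.spatial (poincareInv (Lorentz.boost V hV) 0 y))) := by
    rw [poincareInv_zero]
    conv_lhs => rw [← ((Lorentz.boost V hV : E4 ≃L[ℝ] E4)).apply_symm_apply y]
    rw [Lorentz.coe_boost_apply, Lorentz.boostCLM_apply_zero]
  have hrad : (boostedKerrBackground (Lorentz.boost V hV) 0 M 0).radius y =
      ‖E4.spatial (poincareInv (Lorentz.boost V hV) 0 y)‖ := by
    show Kerr.radius 0 (poincareInv (Lorentz.boost V hV) 0 y) = _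
    rw [Kerr.radius_zero_left, E4.spatialNorm]
  show Lorentz.gamma V * ((poincareInv (Lorentz.boost V hV) 0 y) 0 - ‖V‖ * _) ≤ y 0
  rw [hy, hrad]
  have hγ := Lorentz.gamma_pos hV
  have h := abs_real_inner_le_norm V (E4.spatial (poincareInv (Lorentz.boost V hV) 0 y))
  have h2 := (abs_le.mp h).1
  nlinarith

end Dictionary

end Summit.FinalStateConjecture.FinalStateConjecture.Theorems

end
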